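import Mathlib
import HarnessLib
import Summits.QuantumFields.YangMills.Theorems.MirrorModularBoostsHypercubicLimitFunctionalBoundPlanesWeak
import Summits.QuantumFields.YangMills.Theorems.MirrorModularBoostsHypercubicLimitGevreyStep
import Summits.QuantumFields.YangMills.Theorems.MirrorModularBoostsHypercubicLimitGevreyPairCutoffFamily
import Summits.QuantumFields.YangMills.Theorems.MirrorModularBoostsHypercubicLimitFlatShellDecompositionExplicit
import Summits.QuantumFields.YangMills.Theorems.MirrorModularBoostsHypercubicLimitSeparatedScaleBoundExplicit

/-!
# Line `Sketch` (coupling response), step Z1 closed: smeared moment bounds ⇒ the uniform functional bound on `⁰𝒮`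

Crux `stmt-QuantumFields-16154` (`HypercubicLimit`), line `Sketch`, reshape 8 — the registered stub `stub_functionalBoundPlanes`
(`PolyVolume sch → UniformMomentBoundsPlanes r sch → UniformFunctionalBoundPlanes r sch`), i.e. Osterwalder–Schrader's linear-growth
currency E0′: ONE order `s₁` and constants `α (n!)^β` for all degrees `n`.  Assembly of the explicit pieces: the slot-disjoint
localisation + Summers' engine (`disjointLocalisedBound`, `n`-uniform), the explicit single-scale partition (`separatedScaleBound_explicit`),
the Gevrey step and the explicit pair cutoffs (`exists_gevreyStep`, `gevreyPairCutoffFamily`), the explicit flat shells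
(`flatShellDecomposition_explicit`), density of separated compactly supported tests in `⁰𝒮` and continuity — giving the model-free theorem
`offDiagonal_bound_explicit` — and the model-side disjoint-product bound `planeDist_disjointProductBound`.  The factorial arithmetic
(`(cn)! ≤ (cᶜeᶜ)ⁿ(n!)ᶜ`, `(n+1)^{a(n+1)} ≤ ((2e)ᵃ)^{n+1}(n!)ᵃ`, `Γⁿ ≤ e^Γ n!`) converts the explicit degree dependence into `α (n!)^β`.
(`PolyVolume` is not needed.)  Refs: OsterwalderSchrader1975 §IV.1 + Appendix (Summers); GlimmJaffe1987 §19.1.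
-/

noncomputable section

open scoped SchwartzMap ContDiff
open MeasureTheory Filter Topology
open Literature.MathematicalPhysics.AQFT Literature.MathematicalPhysics.QuantumLattice
open Literature.MathematicalPhysics.QuantumFieldTheory

namespace Summit.QuantumFields.YangMills.Cruxes.HypercubicLimit.CouplingResponse

/-! ### Factorial arithmetic -/

/-- `(n+1)^{n+1} ≤ (2e)^{n+1} n!`. [folklore] -/
theorem succ_pow_succ_le (n : ℕ) : ((n : ℝ) + 1) ^ (n + 1) ≤ (2 * Real.exp 1) ^ (n + 1) * (n.factorial : ℝ) := by
  have h1 : ((n : ℝ) + 1) ^ (n + 1) / ((n + 1).factorial : ℝ) ≤ Real.exp ((n : ℝ) + 1) :=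
    Real.pow_div_factorial_le_exp ((n : ℝ) + 1) (by positivity) (n + 1)
  have hfac : (0 : ℝ) < ((n + 1).factorial : ℝ) := by exact_mod_cast (n + 1).factorial_pos
  rw [div_le_iff₀ hfac] at h1
  have h2 : (((n + 1).factorial : ℕ) : ℝ) = ((n : ℝ) + 1) * (n.factorial : ℝ) := by
    rw [Nat.factorial_succ]; push_cast; ring
  have h3 : ((n : ℝ) + 1) ≤ (2 : ℝ) ^ n := by exact_mod_cast (Nat.lt_two_pow_self (n := n))
  have h4 : Real.exp ((n : ℝ) + 1) = (Real.exp 1) ^ (n + 1) := by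
    rw [show ((n : ℝ) + 1) = ((n + 1 : ℕ) : ℝ) by push_cast; ring, ← Real.exp_one_pow]
  calc ((n : ℝ) + 1) ^ (n + 1) ≤ Real.exp ((n : ℝ) + 1) * ((n + 1).factorial : ℝ) := h1
    _ = (Real.exp 1) ^ (n + 1) * (((n : ℝ) + 1) * (n.factorial : ℝ)) := by rw [h4, h2]
    _ ≤ (Real.exp 1) ^ (n + 1) * ((2 : ℝ) ^ (n + 1) * (n.factorial : ℝ)) := by
        gcongr
        exact h3.trans (pow_le_pow_right₀ (by norm_num) (Nat.le_succ n))
    _ = (2 * Real.exp 1) ^ (n + 1) * (n.factorial : ℝ) := by rw [mul_pow]; ring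

/-- `(n+1)^{a(n+1)} ≤ ((2e)^a)^{n+1} (n!)^a`. [folklore] -/
theorem succ_pow_mul_succ_le (a n : ℕ) :
    ((n : ℝ) + 1) ^ (a * (n + 1)) ≤ ((2 * Real.exp 1) ^ a) ^ (n + 1) * (n.factorial : ℝ) ^ a := by
  calc ((n : ℝ) + 1) ^ (a * (n + 1)) = (((n : ℝ) + 1) ^ (n + 1)) ^ a := by rw [mul_comm, pow_mul]
    _ ≤ ((2 * Real.exp 1) ^ (n + 1) * (n.factorial : ℝ)) ^ a :=
        pow_le_pow_left₀ (by positivity) (succ_pow_succ_le n) a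
    _ = ((2 * Real.exp 1) ^ a) ^ (n + 1) * (n.factorial : ℝ) ^ a := by
        rw [mul_pow, ← pow_mul, ← pow_mul, mul_comm (n + 1) a]

/-- `nⁿ ≤ eⁿ n!`. [folklore] -/
theorem self_pow_le_exp_mul_factorial (n : ℕ) : ((n : ℝ)) ^ n ≤ (Real.exp 1) ^ n * (n.factorial : ℝ) := by
  have h1 : ((n : ℝ)) ^ n / (n.factorial : ℝ) ≤ Real.exp (n : ℝ) := Real.pow_div_factorial_le_exp (n : ℝ) (by positivity) n
  have hfac : (0 : ℝ) < (n.factorial : ℝ) := by exact_mod_cast n.factorial_pos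
  rw [div_le_iff₀ hfac] at h1
  have h4 : Real.exp (n : ℝ) = (Real.exp 1) ^ n := by rw [← Real.exp_one_pow]
  rwa [h4] at h1

/-- `(c n)! ≤ (cᶜ eᶜ)ⁿ (n!)ᶜ`. [folklore] -/
theorem factorial_mul_le (c n : ℕ) :
    (((c * n).factorial : ℕ) : ℝ) ≤ ((c : ℝ) ^ c * (Real.exp 1) ^ c) ^ n * (n.factorial : ℝ) ^ c := by
  have h1 : (((c * n).factorial : ℕ) : ℝ) ≤ ((c * n : ℕ) : ℝ) ^ (c * n) := by
    exact_mod_cast Nat.factorial_le_pow (c * n)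
  calc (((c * n).factorial : ℕ) : ℝ) ≤ ((c * n : ℕ) : ℝ) ^ (c * n) := h1
    _ = ((c : ℝ) ^ c) ^ n * (((n : ℝ)) ^ n) ^ c := by
        push_cast
        rw [mul_pow, pow_mul, pow_mul, ← pow_mul (n : ℝ) n c, mul_comm n c, pow_mul]
    _ ≤ ((c : ℝ) ^ c) ^ n * ((Real.exp 1) ^ n * (n.factorial : ℝ)) ^ c := by
        gcongr
        exact self_pow_le_exp_mul_factorial n
    _ = ((c : ℝ) ^ c * (Real.exp 1) ^ c) ^ n * (n.factorial : ℝ) ^ c := by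
        rw [mul_pow, mul_pow, ← pow_mul, ← pow_mul, mul_comm n c]; ring

/-- `Γⁿ ≤ e^Γ n!`. [folklore] -/
theorem pow_le_exp_mul_factorial {Γ : ℝ} (hΓ : 0 ≤ Γ) (n : ℕ) : Γ ^ n ≤ Real.exp Γ * (n.factorial : ℝ) := by
  have h := Real.pow_div_factorial_le_exp Γ hΓ n
  have hfac : (0 : ℝ) < (n.factorial : ℝ) := by exact_mod_cast n.factorial_pos
  rwa [div_le_iff₀ hfac] at h


/-- The seminorm order of the explicit assembly is linear in the degree. [folklore] -/
theorem order_le_linear (n t : ℕ) (hn : 0 < n) :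
    2 * (n * (4 * t + 12)) + (16 * n * (t + 3) + 1) + 1 ≤ n * (24 * t + 74) := by
  have key : 2 * (n * (4 * t + 12)) + (16 * n * (t + 3) + 1) + 1 = 24 * (n * t) + 72 * n + 2 := by ring
  have key2 : n * (24 * t + 74) = 24 * (n * t) + 74 * n := by ring
  rw [key, key2]
  omega

/-- Exponent bookkeeping (a). [folklore] -/
theorem expo_a (n a : ℕ) : a * n ≤ a * (n + 1) := Nat.mul_le_mul_left _ (Nat.le_succ n)
/-- Exponent bookkeeping (b). [folklore] -/
theorem expo_b (n c : ℕ) : n * c + 1 ≤ (c + 1) * (n + 1) := by nlinarith [Nat.zero_le n, Nat.zero_le c]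
/-- Exponent bookkeeping (c). [folklore] -/
theorem expo_c (n c : ℕ) : 2 * (n * c + 1) ≤ (2 * c + 2) * (n + 1) := by nlinarith [Nat.zero_le n, Nat.zero_le c]

/-- **The per-degree constant is of factorial type**: with
`Γ = K₁ A₄ (2e)^{2(t+3)} 128^{16(t+3)} (64A₂)^{4t+13} (2e)^{2(4t+12)+2} 2^{16(t+3)+1} ((4t+12)^{4t+12} e^{4t+12})³`,
the constant of degree `n` is at most `2 Γ^{n+1} (n!)^{22t+68}`. [folklore] -/
theorem perDegreeConstant_le (t : ℕ) {K K₁ A₄ A₂ : ℝ} (hK : 0 ≤ K) (hKK₁ : K ≤ K₁) (hK₁1 : 1 ≤ K₁) (hA₄ : 1 ≤ A₄)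
    (hA₂ : 1 ≤ A₂) (n : ℕ) :
    K ^ n * A₄ ^ (n + 1) * ((n : ℝ) + 1) ^ (2 * n * (t + 3)) * (128 : ℝ) ^ (16 * n * (t + 3)) *
        ((64 * (A₂ * ((n : ℝ) + 1) ^ 2)) ^ (n * (4 * t + 12) + 1) * (2 : ℝ) ^ (16 * n * (t + 3) + 1) *
          (((n * (4 * t + 12)).factorial : ℝ)) ^ 3) * 2 ≤
      2 * (K₁ * A₄ * (2 * Real.exp 1) ^ (2 * (t + 3)) * (128 : ℝ) ^ (16 * (t + 3)) * (64 * A₂) ^ (4 * t + 12 + 1) *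
        (2 * Real.exp 1) ^ (2 * (4 * t + 12) + 2) * (2 : ℝ) ^ (16 * (t + 3) + 1) *
        (((4 * t + 12 : ℕ) : ℝ) ^ (4 * t + 12) * (Real.exp 1) ^ (4 * t + 12)) ^ 3) ^ (n + 1) *
        (n.factorial : ℝ) ^ (22 * t + 68) := by
  obtain ⟨c, hc⟩ : ∃ c : ℕ, c = 4 * t + 12 := ⟨_, rfl⟩
  rw [← hc]
  have he1 : (1 : ℝ) ≤ 2 * Real.exp 1 := by have := Real.one_lt_exp_iff.2 one_pos; linarith
  have hcc : (1 : ℝ) ≤ (c : ℝ) ^ c * (Real.exp 1) ^ c := by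
    have h1 : (1 : ℝ) ≤ (c : ℝ) ^ c := by
      rcases Nat.eq_zero_or_pos c with h | h
      · simp [h]
      · exact one_le_pow₀ (by exact_mod_cast h)
    exact one_le_mul_of_one_le_of_one_le h1 (one_le_pow₀ (Real.one_lt_exp_iff.2 one_pos).le)
  have hfac1 : (1 : ℝ) ≤ (n.factorial : ℝ) := by exact_mod_cast n.factorial_pos
  have hn1 : (1 : ℝ) ≤ (n : ℝ) + 1 := by have := n.cast_nonneg (α := ℝ); linarith only [this]
  have hKn : K ^ n ≤ K₁ ^ (n + 1) :=
    (pow_le_pow_left₀ hK hKK₁ n).trans (pow_le_pow_right₀ hK₁1 (Nat.le_succ n))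
  have hN1 : ((n : ℝ) + 1) ^ (2 * n * (t + 3)) ≤ ((2 * Real.exp 1) ^ (2 * (t + 3))) ^ (n + 1) * (n.factorial : ℝ) ^ (2 * (t + 3)) :=
    calc ((n : ℝ) + 1) ^ (2 * n * (t + 3)) ≤ ((n : ℝ) + 1) ^ ((2 * (t + 3)) * (n + 1)) :=
          pow_le_pow_right₀ hn1 (by rw [show 2 * n * (t + 3) = (2 * (t + 3)) * n by ring]; exact expo_a n _)
      _ ≤ _ := succ_pow_mul_succ_le (2 * (t + 3)) n
  have h128 : (128 : ℝ) ^ (16 * n * (t + 3)) ≤ ((128 : ℝ) ^ (16 * (t + 3))) ^ (n + 1) := by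
    rw [← pow_mul]
    exact pow_le_pow_right₀ (by norm_num) (by rw [show 16 * n * (t + 3) = (16 * (t + 3)) * n by ring]; exact expo_a n _)
  have h64A : (1 : ℝ) ≤ 64 * A₂ := by linarith only [hA₂]
  have h64B : (64 * (A₂ * ((n : ℝ) + 1) ^ 2)) ^ (n * c + 1) ≤ ((64 * A₂) ^ (c + 1)) ^ (n + 1) *
      (((2 * Real.exp 1) ^ (2 * c + 2)) ^ (n + 1) * (n.factorial : ℝ) ^ (2 * c + 2)) := by
    have hsplit : (64 * (A₂ * ((n : ℝ) + 1) ^ 2)) ^ (n * c + 1) = (64 * A₂) ^ (n * c + 1) * ((n : ℝ) + 1) ^ (2 * (n * c + 1)) := by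
      rw [show (64 : ℝ) * (A₂ * ((n : ℝ) + 1) ^ 2) = (64 * A₂) * ((n : ℝ) + 1) ^ 2 by ring, mul_pow, ← pow_mul]
    rw [hsplit]
    refine mul_le_mul ?_ ?_ (by positivity) (by positivity)
    · rw [← pow_mul]
      exact pow_le_pow_right₀ h64A (expo_b n _)
    · calc ((n : ℝ) + 1) ^ (2 * (n * c + 1)) ≤ ((n : ℝ) + 1) ^ ((2 * c + 2) * (n + 1)) :=
            pow_le_pow_right₀ hn1 (expo_c n _)
        _ ≤ _ := succ_pow_mul_succ_le (2 * c + 2) n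
  have h2p : (2 : ℝ) ^ (16 * n * (t + 3) + 1) ≤ ((2 : ℝ) ^ (16 * (t + 3) + 1)) ^ (n + 1) := by
    rw [← pow_mul]
    exact pow_le_pow_right₀ (by norm_num) (by rw [show 16 * n * (t + 3) = n * (16 * (t + 3)) by ring]; exact expo_b n _)
  have htfac : ((((n * c).factorial : ℕ) : ℝ)) ^ 3 ≤ (((c : ℝ) ^ c * (Real.exp 1) ^ c) ^ 3) ^ (n + 1) * (n.factorial : ℝ) ^ (3 * c) := by
    have h1 : ((((n * c).factorial : ℕ) : ℝ)) ≤ ((c : ℝ) ^ c * (Real.exp 1) ^ c) ^ n * (n.factorial : ℝ) ^ c := by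
      rw [mul_comm n c]; exact factorial_mul_le c n
    calc ((((n * c).factorial : ℕ) : ℝ)) ^ 3 ≤ (((c : ℝ) ^ c * (Real.exp 1) ^ c) ^ n * (n.factorial : ℝ) ^ c) ^ 3 :=
          pow_le_pow_left₀ (by positivity) h1 3
      _ = (((c : ℝ) ^ c * (Real.exp 1) ^ c) ^ 3) ^ n * (n.factorial : ℝ) ^ (3 * c) := by
          rw [mul_pow, ← pow_mul, ← pow_mul, mul_comm n 3, mul_comm c 3, pow_mul, pow_mul]
      _ ≤ (((c : ℝ) ^ c * (Real.exp 1) ^ c) ^ 3) ^ (n + 1) * (n.factorial : ℝ) ^ (3 * c) := by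
          gcongr
          · exact one_le_pow₀ hcc
          · exact Nat.le_succ n
  calc K ^ n * A₄ ^ (n + 1) * ((n : ℝ) + 1) ^ (2 * n * (t + 3)) * (128 : ℝ) ^ (16 * n * (t + 3)) *
        ((64 * (A₂ * ((n : ℝ) + 1) ^ 2)) ^ (n * c + 1) * (2 : ℝ) ^ (16 * n * (t + 3) + 1) *
          ((((n * c).factorial : ℕ) : ℝ)) ^ 3) * 2
      ≤ K₁ ^ (n + 1) * A₄ ^ (n + 1) * (((2 * Real.exp 1) ^ (2 * (t + 3))) ^ (n + 1) * (n.factorial : ℝ) ^ (2 * (t + 3))) *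
          ((128 : ℝ) ^ (16 * (t + 3))) ^ (n + 1) *
          ((((64 * A₂) ^ (c + 1)) ^ (n + 1) * (((2 * Real.exp 1) ^ (2 * c + 2)) ^ (n + 1) * (n.factorial : ℝ) ^ (2 * c + 2))) *
            ((2 : ℝ) ^ (16 * (t + 3) + 1)) ^ (n + 1) *
            ((((c : ℝ) ^ c * (Real.exp 1) ^ c) ^ 3) ^ (n + 1) * (n.factorial : ℝ) ^ (3 * c))) * 2 := by
        gcongr
    _ = 2 * (K₁ * A₄ * (2 * Real.exp 1) ^ (2 * (t + 3)) * (128 : ℝ) ^ (16 * (t + 3)) * (64 * A₂) ^ (c + 1) *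
          (2 * Real.exp 1) ^ (2 * c + 2) * (2 : ℝ) ^ (16 * (t + 3) + 1) * ((c : ℝ) ^ c * (Real.exp 1) ^ c) ^ 3) ^ (n + 1) *
          (n.factorial : ℝ) ^ (22 * t + 68) := by
        subst hc
        generalize (2 : ℝ) = w
        generalize (64 : ℝ) = u
        generalize (128 : ℝ) = v
        ring

/-! ### The model-free extension with explicit degree dependence -/

/-- **From disjoint-product bounds to bounds on `⁰𝒮ₙ`, explicit in the degree.**  For every order `s` there are `s₁, b` and `α ≥ 1`
such that for ALL `n`, every continuous linear functional `T` on `𝓢((ℝ⁴)ⁿ, ℂ)` bounded by `M ∏ᵢ |φᵢ|_s` on tensor products of one-point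
tests with pairwise disjoint supports satisfies `‖T F‖ ≤ M α (n!)ᵇ |F|_{n s₁}` on `⁰𝒮ₙ`.
[cite: OsterwalderSchraderCMP1975, Appendix (S. Summers)] -/
theorem offDiagonal_bound_explicit (s : ℕ) :
    ∃ (s₁ b : ℕ) (α : ℝ), 1 ≤ α ∧ ∀ (n : ℕ) (T : 𝓢((Fin n → EuclideanSpace ℝ (Fin 4)), ℂ) →L[ℂ] ℂ) (M : ℝ), 0 ≤ M →
      (∀ (φ : Fin n → 𝓢(EuclideanSpace ℝ (Fin 4), ℂ)),
        (∀ i j, i ≠ j → Disjoint (tsupport (φ i : EuclideanSpace ℝ (Fin 4) → ℂ)) (tsupport (φ j : EuclideanSpace ℝ (Fin 4) → ℂ))) →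
        ∀ F : 𝓢((Fin n → EuclideanSpace ℝ (Fin 4)), ℂ), IsTensorOf F φ → ‖T F‖ ≤ M * ∏ i, schwartzNorm s (φ i)) →
      ∀ F : 𝓢((Fin n → EuclideanSpace ℝ (Fin 4)), ℂ), IsOffDiagonal F →
        ‖T F‖ ≤ M * (α * (n.factorial : ℝ) ^ b) * schwartzNorm (n * s₁) F := by
  obtain ⟨t, K, hK, hB⟩ := disjointLocalisedBound s
  obtain ⟨A₄, hA₄, hE4⟩ := separatedScaleBound_explicit t
  obtain ⟨g, Cg, hCg, hg1, hg2, hg3, hg4, hg5⟩ := exists_gevreyStep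
  obtain ⟨A₂, hA₂, hfam⟩ := gevreyPairCutoffFamily g Cg hCg hg1 hg2 hg3 hg4 hg5
  -- the universal constant
  obtain ⟨K₁, hK₁⟩ : ∃ K₁ : ℝ, K₁ = max K 1 := ⟨_, rfl⟩
  have hK₁1 : 1 ≤ K₁ := hK₁ ▸ le_max_right _ _
  have hKK₁ : K ≤ K₁ := hK₁ ▸ le_max_left _ _
  obtain ⟨Γ, hΓ⟩ : ∃ Γ : ℝ, Γ = K₁ * A₄ * (2 * Real.exp 1) ^ (2 * (t + 3)) * (128 : ℝ) ^ (16 * (t + 3)) * (64 * A₂) ^ (4 * t + 12 + 1) *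
      (2 * Real.exp 1) ^ (2 * (4 * t + 12) + 2) * (2 : ℝ) ^ (16 * (t + 3) + 1) *
      (((4 * t + 12 : ℕ) : ℝ) ^ (4 * t + 12) * (Real.exp 1) ^ (4 * t + 12)) ^ 3 := ⟨_, rfl⟩
  have hΓ1 : 1 ≤ Γ := by
    have h := perDegreeConstant_le t hK hKK₁ hK₁1 hA₄ hA₂ 0
    rw [← hΓ] at h
    -- at degree zero the left-hand side is `A₄ · 64 A₂ · 2 · 2 ≥ 2`, the right-hand side `2 Γ`
    have hl : (2 : ℝ) ≤ K ^ 0 * A₄ ^ (0 + 1) * (((0 : ℕ) : ℝ) + 1) ^ (2 * 0 * (t + 3)) * (128 : ℝ) ^ (16 * 0 * (t + 3)) *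
        ((64 * (A₂ * (((0 : ℕ) : ℝ) + 1) ^ 2)) ^ (0 * (4 * t + 12) + 1) * (2 : ℝ) ^ (16 * 0 * (t + 3) + 1) *
          (((0 * (4 * t + 12)).factorial : ℝ)) ^ 3) * 2 := by
      simp only [pow_zero, zero_add, Nat.cast_zero, mul_zero, zero_mul, pow_one, Nat.factorial_zero, Nat.cast_one, one_pow,
        mul_one, one_mul]
      nlinarith
    have h2 : (2 : ℝ) ≤ 2 * Γ ^ (0 + 1) * ((Nat.factorial 0 : ℕ) : ℝ) ^ (22 * t + 68) := hl.trans h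
    simp only [zero_add, pow_one, Nat.factorial_zero, Nat.cast_one, one_pow, mul_one] at h2
    linarith
  have hΓ0 : 0 ≤ Γ := by linarith
  refine ⟨24 * t + 74, 22 * t + 69, 2 * Γ * Real.exp Γ, ?_, fun n T M hM hT F hF => ?_⟩
  · have : (1 : ℝ) ≤ Real.exp Γ := Real.one_le_exp hΓ0
    nlinarith
  -- degree zero: constant functions on a point
  rcases Nat.eq_zero_or_pos n with hn0 | hnpos
  · subst hn0
    have hF1 : F = (F default) • (SchwartzMap.constOfSubsingleton 1 : 𝓢((Fin 0 → EuclideanSpace ℝ (Fin 4)), ℂ)) := by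
      ext x; rw [Subsingleton.elim x default]; simp
    have h1 : ‖T (SchwartzMap.constOfSubsingleton 1)‖ ≤ M := by
      have h := hT Fin.elim0 (fun i j hij => (hij (Subsingleton.elim i j)).elim) (SchwartzMap.constOfSubsingleton 1)
        (fun x => by simp)
      simpa using h
    have h2 : ‖F default‖ ≤ schwartzNorm (0 * (24 * t + 74)) F := norm_le_schwartzNorm _ F default
    have h3 : (1 : ℝ) ≤ 2 * Γ * Real.exp Γ * ((Nat.factorial 0 : ℕ) : ℝ) ^ (22 * t + 69) := by
      simp only [Nat.factorial_zero, Nat.cast_one, one_pow, mul_one]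
      have : (1 : ℝ) ≤ Real.exp Γ := Real.one_le_exp hΓ0
      nlinarith
    calc ‖T F‖ = ‖F default‖ * ‖T (SchwartzMap.constOfSubsingleton 1)‖ := by
          rw [hF1, map_smul, norm_smul]; simp
      _ ≤ schwartzNorm (0 * (24 * t + 74)) F * M := mul_le_mul h2 h1 (norm_nonneg _) (schwartzNorm_nonneg _ _)
      _ = M * 1 * schwartzNorm (0 * (24 * t + 74)) F := by ring
      _ ≤ M * (2 * Γ * Real.exp Γ * ((Nat.factorial 0 : ℕ) : ℝ) ^ (22 * t + 69)) * schwartzNorm (0 * (24 * t + 74)) F := by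
          gcongr
          exact schwartzNorm_nonneg _ _
  -- positive degree
  have hloc := hB n T M hM hT
  obtain ⟨B, hBdef⟩ : ∃ B : ℝ, B = A₂ * ((n : ℝ) + 1) ^ 2 := ⟨_, rfl⟩
  have hB1 : 1 ≤ B := hBdef ▸ one_le_mul_of_one_le_of_one_le hA₂ (one_le_pow₀ (by linarith))
  have hB0 : 0 ≤ B := by linarith only [hB1]
  have hfamn : ∀ κ : ℝ, 1 ≤ κ → ∃ ψ : (Fin n → EuclideanSpace ℝ (Fin 4)) → ℝ, ContDiff ℝ ∞ ψ ∧ (∀ x, 0 ≤ ψ x ∧ ψ x ≤ 1) ∧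
      (∀ x, (∀ i j, i ≠ j → 2 / κ ≤ ‖x i - x j‖) → ψ x = 1) ∧ (∀ x, (∃ i j, i ≠ j ∧ ‖x i - x j‖ ≤ 1 / κ) → ψ x = 0) ∧
      ∀ (l : ℕ) (x : Fin n → EuclideanSpace ℝ (Fin 4)), ‖iteratedFDeriv ℝ l ψ x‖ ≤ (B * κ) ^ l * ((l.factorial : ℝ)) ^ 3 := by
    intro κ hκ; rw [hBdef]; exact hfam n κ hκ
  have hD := flatShellDecomposition_explicit n B hB1 hfamn
  obtain ⟨t', ht'⟩ : ∃ t' : ℕ, t' = n * (4 * t + 12) := ⟨_, rfl⟩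
  obtain ⟨p, hp⟩ : ∃ p : ℕ, p = 16 * n * (t + 3) := ⟨_, rfl⟩
  -- the per-degree constant and its factorial bound
  obtain ⟨D, hDdef⟩ : ∃ D : ℝ, D = K ^ n * A₄ ^ (n + 1) * ((n : ℝ) + 1) ^ (2 * n * (t + 3)) * (128 : ℝ) ^ p *
    ((64 * B) ^ (t' + 1) * (2 : ℝ) ^ (p + 1) * ((t'.factorial : ℝ)) ^ 3) * 2 := ⟨_, rfl⟩
  have hD0 : 0 ≤ D := by rw [hDdef]; positivity
  -- (1) the bound on compactly supported separated off-diagonal tests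
  have hsep : ∀ u : 𝓢((Fin n → EuclideanSpace ℝ (Fin 4)), ℂ), IsOffDiagonal u →
      HasCompactSupport (u : (Fin n → EuclideanSpace ℝ (Fin 4)) → ℂ) →
      (∃ δ : ℝ, 0 < δ ∧ ∀ x ∈ tsupport (u : (Fin n → EuclideanSpace ℝ (Fin 4)) → ℂ), ∀ i j, i ≠ j → δ ≤ ‖x i - x j‖) →
      ‖T u‖ ≤ M * D * schwartzNorm (2 * t' + (p + 1) + 1) u := by
    intro u hu huc husep
    obtain ⟨J, v, huv, hv⟩ := hD t' (p + 1) u hu huc husep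
    have hterm : ∀ j, ‖T (v j)‖ ≤ M * (K ^ n * A₄ ^ (n + 1) * ((n : ℝ) + 1) ^ (2 * n * (t + 3)) * (128 : ℝ) ^ p *
        ((64 * B) ^ (t' + 1) * (2 : ℝ) ^ (p + 1) * ((t'.factorial : ℝ)) ^ 3)) * (2 : ℝ)⁻¹ ^ j *
        schwartzNorm (2 * t' + (p + 1) + 1) u := by
      intro j
      obtain ⟨hvc, hvsep, hvn⟩ := hv j
      set ε : ℝ := (2 : ℝ)⁻¹ ^ (j + 1) / 64 with hε
      have hε0 : 0 < ε := by positivity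
      have hε1 : ε ≤ 1 := by
        rw [hε, div_le_one (by norm_num)]
        exact (pow_le_one₀ (by norm_num) (by norm_num)).trans (by norm_num)
      have h64 : ∀ x ∈ tsupport (v j : (Fin n → EuclideanSpace ℝ (Fin 4)) → ℂ), ∀ i i', i ≠ i' → 64 * ε ≤ ‖x i - x i'‖ := by
        intro x hx i i' hii'
        have : 64 * ε = (2 : ℝ)⁻¹ ^ (j + 1) := by rw [hε]; ring
        rw [this]
        exact hvsep x hx i i' hii'
      have h1 := hE4 n T M K hM hK hloc ε hε0 hε1 (v j) hvc h64
      rw [← hp, ← ht'] at h1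
      have hεinv : ε⁻¹ = 128 * (2 : ℝ) ^ j := by
        rw [hε, inv_pow, pow_succ, inv_div]
        field_simp
        norm_num
      have hεp : ε⁻¹ ^ p = (128 : ℝ) ^ p * (2 : ℝ) ^ (p * j) := by
        rw [hεinv, mul_pow, ← pow_mul, mul_comm j p]
      have hpow : (2 : ℝ) ^ (p * j) * (2 : ℝ)⁻¹ ^ ((p + 1) * j) = (2 : ℝ)⁻¹ ^ j := by
        rw [add_mul, one_mul, pow_add, inv_pow, inv_pow]
        field_simp
      calc ‖T (v j)‖ ≤ M * K ^ n * A₄ ^ (n + 1) * ((n : ℝ) + 1) ^ (2 * n * (t + 3)) * ε⁻¹ ^ p *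
            schwartzNorm t' (v j) := h1
        _ ≤ M * K ^ n * A₄ ^ (n + 1) * ((n : ℝ) + 1) ^ (2 * n * (t + 3)) * ε⁻¹ ^ p *
            ((64 * B) ^ (t' + 1) * (2 : ℝ) ^ (p + 1) * ((t'.factorial : ℝ)) ^ 3 * (2 : ℝ)⁻¹ ^ ((p + 1) * j) *
              schwartzNorm (2 * t' + (p + 1) + 1) u) := by
            gcongr
        _ = M * (K ^ n * A₄ ^ (n + 1) * ((n : ℝ) + 1) ^ (2 * n * (t + 3)) * (128 : ℝ) ^ p *
            ((64 * B) ^ (t' + 1) * (2 : ℝ) ^ (p + 1) * ((t'.factorial : ℝ)) ^ 3)) * (2 : ℝ)⁻¹ ^ j *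
            schwartzNorm (2 * t' + (p + 1) + 1) u := by
            rw [hεp, ← hpow]; ring
    calc ‖T u‖ = ‖∑ j ∈ Finset.range J, T (v j)‖ := by rw [huv, map_sum]
      _ ≤ ∑ j ∈ Finset.range J, ‖T (v j)‖ := norm_sum_le _ _
      _ ≤ ∑ j ∈ Finset.range J, M * (K ^ n * A₄ ^ (n + 1) * ((n : ℝ) + 1) ^ (2 * n * (t + 3)) * (128 : ℝ) ^ p *
            ((64 * B) ^ (t' + 1) * (2 : ℝ) ^ (p + 1) * ((t'.factorial : ℝ)) ^ 3)) * (2 : ℝ)⁻¹ ^ j *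
            schwartzNorm (2 * t' + (p + 1) + 1) u := Finset.sum_le_sum fun j _ => hterm j
      _ = M * (K ^ n * A₄ ^ (n + 1) * ((n : ℝ) + 1) ^ (2 * n * (t + 3)) * (128 : ℝ) ^ p *
            ((64 * B) ^ (t' + 1) * (2 : ℝ) ^ (p + 1) * ((t'.factorial : ℝ)) ^ 3)) *
            (∑ j ∈ Finset.range J, (2 : ℝ)⁻¹ ^ j) * schwartzNorm (2 * t' + (p + 1) + 1) u := by
          rw [Finset.mul_sum, Finset.sum_mul]
      _ ≤ M * (K ^ n * A₄ ^ (n + 1) * ((n : ℝ) + 1) ^ (2 * n * (t + 3)) * (128 : ℝ) ^ p *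
            ((64 * B) ^ (t' + 1) * (2 : ℝ) ^ (p + 1) * ((t'.factorial : ℝ)) ^ 3)) * 2 *
            schwartzNorm (2 * t' + (p + 1) + 1) u := by
          have hgeom : ∑ j ∈ Finset.range J, (2 : ℝ)⁻¹ ^ j ≤ 2 := by
            have := geom_sum_Ico_le_of_lt_one (x := (2 : ℝ)⁻¹) (m := 0) (n := J) (by norm_num) (by norm_num)
            simp only [pow_zero] at this
            rw [Finset.range_eq_Ico]
            exact this.trans (by norm_num)
          have hpos : 0 ≤ M * (K ^ n * A₄ ^ (n + 1) * ((n : ℝ) + 1) ^ (2 * n * (t + 3)) * (128 : ℝ) ^ p *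
            ((64 * B) ^ (t' + 1) * (2 : ℝ) ^ (p + 1) * ((t'.factorial : ℝ)) ^ 3)) := by positivity
          exact mul_le_mul_of_nonneg_right (mul_le_mul_of_nonneg_left hgeom hpos) (schwartzNorm_nonneg _ _)
      _ = M * D * schwartzNorm (2 * t' + (p + 1) + 1) u := by rw [hDdef]; ring
  -- (2) density of compactly supported separated tests in `⁰𝒮`, and continuity
  have hall : ‖T F‖ ≤ M * D * schwartzNorm (2 * t' + (p + 1) + 1) F := by
    obtain ⟨u, huc, husep, hlim⟩ :=
      Summit.QuantumFields.YangMills.Cruxes.OSLegsAtWeakCouplingC.Sketch.exists_separated_tendsto_of_isOffDiagonal F hF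
    have hu_off : ∀ m, IsOffDiagonal (u m) := by
      intro m
      obtain ⟨δ, hδ, hsub⟩ := husep m
      refine IsOffDiagonal.of_tsupport_subset ?_
      intro x hx hxc
      obtain ⟨i, j, hij, hxij⟩ := hxc
      have h := hsub hx i j hij
      rw [hxij, dist_self] at h
      exact absurd h (not_le.2 hδ)
    have hu_sep : ∀ m, ∃ δ : ℝ, 0 < δ ∧ ∀ x ∈ tsupport (u m : (Fin n → EuclideanSpace ℝ (Fin 4)) → ℂ),
        ∀ i j, i ≠ j → δ ≤ ‖x i - x j‖ := by
      intro m
      obtain ⟨δ, hδ, hsub⟩ := husep m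
      exact ⟨δ, hδ, fun x hx i j hij => by rw [← dist_eq_norm]; exact hsub hx i j hij⟩
    have hbound : ∀ m, ‖T (u m)‖ ≤ M * D * schwartzNorm (2 * t' + (p + 1) + 1) (u m) :=
      fun m => hsep (u m) (hu_off m) (huc m) (hu_sep m)
    have hqc : Continuous fun G : 𝓢((Fin n → EuclideanSpace ℝ (Fin 4)), ℂ) => schwartzNorm (2 * t' + (p + 1) + 1) G :=
      Seminorm.continuous_finsetSup (s := Finset.Iic (2 * t' + (p + 1) + 1, 2 * t' + (p + 1) + 1)) fun i _ =>
        (schwartz_withSeminorms ℂ (Fin n → EuclideanSpace ℝ (Fin 4)) ℂ).continuous_seminorm i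
    have hl : Tendsto (fun m => ‖T (u m)‖) atTop (𝓝 ‖T F‖) :=
      (continuous_norm.tendsto _).comp ((T.continuous.tendsto _).comp hlim)
    have hr : Tendsto (fun m => M * D * schwartzNorm (2 * t' + (p + 1) + 1) (u m)) atTop
        (𝓝 (M * D * schwartzNorm (2 * t' + (p + 1) + 1) F)) :=
      ((hqc.tendsto _).comp hlim).const_mul _
    exact le_of_tendsto_of_tendsto' hl hr hbound
  -- (3) the order: `2 t' + p + 2 ≤ n (24 t + 74)` for `n ≥ 1`
  have horder : 2 * t' + (p + 1) + 1 ≤ n * (24 * t + 74) := by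
    rw [ht', hp]; exact order_le_linear n t hnpos
  have hnorm : schwartzNorm (2 * t' + (p + 1) + 1) F ≤ schwartzNorm (n * (24 * t + 74)) F := schwartzNorm_mono horder F
  -- (4) the constant: `D ≤ 2 Γ e^Γ (n!)^(22 t + 69)`
  have hDle : D ≤ 2 * Γ ^ (n + 1) * (n.factorial : ℝ) ^ (22 * t + 68) := by
    rw [hDdef, hBdef, ht', hp, hΓ]
    exact perDegreeConstant_le t hK hKK₁ hK₁1 hA₄ hA₂ n
  have hΓn : Γ ^ (n + 1) ≤ Γ * Real.exp Γ * (n.factorial : ℝ) := by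
    rw [pow_succ', mul_assoc]
    exact mul_le_mul_of_nonneg_left (pow_le_exp_mul_factorial hΓ0 n) hΓ0
  have hDfinal : D ≤ 2 * Γ * Real.exp Γ * (n.factorial : ℝ) ^ (22 * t + 69) := by
    calc D ≤ 2 * Γ ^ (n + 1) * (n.factorial : ℝ) ^ (22 * t + 68) := hDle
      _ ≤ 2 * (Γ * Real.exp Γ * (n.factorial : ℝ)) * (n.factorial : ℝ) ^ (22 * t + 68) := by
          have h0 : (0 : ℝ) ≤ (n.factorial : ℝ) ^ (22 * t + 68) := by positivity
          exact mul_le_mul_of_nonneg_right (mul_le_mul_of_nonneg_left hΓn (by norm_num)) h0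
      _ = 2 * Γ * Real.exp Γ * (n.factorial : ℝ) ^ (22 * t + 69) := by ring
  calc ‖T F‖ ≤ M * D * schwartzNorm (2 * t' + (p + 1) + 1) F := hall
    _ ≤ M * (2 * Γ * Real.exp Γ * (n.factorial : ℝ) ^ (22 * t + 69)) * schwartzNorm (n * (24 * t + 74)) F :=
        mul_le_mul (mul_le_mul_of_nonneg_left hDfinal hM) hnorm (schwartzNorm_nonneg _ _) (by positivity)

/-! ### The registered stub Z1 -/

/-- **Registered stub `stub_functionalBoundPlanes` (Z1) of line `Sketch` — smeared → functional.**  Along a scheme with the `k`-uniform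
plane-resolved `n!`-moment bounds, every renormalised plane-string distribution obeys the `k`-UNIFORM linear-growth bound
`‖planeDist r sch k n q F‖ ≤ α (n!)^β |F|_{n s₁}` on `⁰𝒮ₙ`, for all degrees `n` and strings `q`. [folklore] -/
theorem stub_functionalBoundPlanes :
    ∀ (G : Type) [Group G] [TopologicalSpace G] [IsTopologicalGroup G] [CompactSpace G]
      [MeasurableSpace G] [BorelSpace G] (r : LatticeRep G) (sch : SpeciesScheme (YMSpecies G)),
      PolyVolume sch → UniformMomentBoundsPlanes r sch → UniformFunctionalBoundPlanes r sch := by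
  intro G _ _ _ _ _ _ r sch _ hUMB
  obtain ⟨s, C₀, C₁, hC₀, hC₁, hprod⟩ := planeDist_disjointProductBound G r sch hUMB
  obtain ⟨s₁, b, α, hα, hext⟩ := offDiagonal_bound_explicit s
  refine ⟨s₁, C₀ * Real.exp C₁ * α, ((b + 2 : ℕ) : ℝ), fun n q F hF k => ?_⟩
  have h := hext n (planeDist r sch k n q) (C₀ * C₁ ^ n * (n.factorial : ℝ)) (by positivity)
    (fun φ hφ F' hF' => hprod k n q φ hφ F' hF') F hF
  have hC₁n : C₁ ^ n ≤ Real.exp C₁ * (n.factorial : ℝ) := pow_le_exp_mul_factorial hC₁ n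
  rw [Real.rpow_natCast]
  calc ‖planeDist r sch k n q F‖ ≤ C₀ * C₁ ^ n * (n.factorial : ℝ) * (α * (n.factorial : ℝ) ^ b) * schwartzNorm (n * s₁) F := h
    _ ≤ C₀ * (Real.exp C₁ * (n.factorial : ℝ)) * (n.factorial : ℝ) * (α * (n.factorial : ℝ) ^ b) * schwartzNorm (n * s₁) F := by
        gcongr
        · exact schwartzNorm_nonneg _ _
    _ = C₀ * Real.exp C₁ * α * (n.factorial : ℝ) ^ (b + 2) * schwartzNorm (n * s₁) F := by ring

end Summit.QuantumFields.YangMills.Cruxes.HypercubicLimit.CouplingResponse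

end
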